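import Literature.ModelTheory.ExponentialFields.RestrictedExp
import Literature.ModelTheory.ExponentialFields.OMinimalOfModelComplete
import HarnessLib

/-!
# Consequences of Wilkie's First Main Theorem for `exp↾[0,1]` on the reducts of the models of `T_exp`

Topic `Literature/ModelTheory/ExponentialFields`.  Let `T_{exp↾} = Th(ℝ; +, ·, -, 0, 1, exp↾[0,1], ≤)`
(`RestrictedExp.lean`; den Besten 2016, Definition 1.2.2).  Wilkie's First Main Theorem in the
case of Example (A) (J. Amer. Math. Soc. 9 (1996), p. 1053; den Besten, Theorem 2.1.1) is the
statement `rexpTheory.IsModelComplete`.  Granting it as a hypothesis, this file derives for the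
`exp↾`-reducts `K | L_{exp↾}` of the models `k ⊆ K` of `T_exp`:

* `RealExpModel.isOMinimal_orderedRexpRing_of_isModelComplete`: **every `K | L_{exp↾}` is
  o-minimal** (den Besten, Corollary 4.1.7 "every model of `T_{Pf↾}` is o-minimal", there from
  van den Dries' o-minimality of `ℝ_an`; here from Khovanskii's finiteness theorem through the
  engine `OMinimalOfModelComplete.lean`, the graph of `exp↾` being quantifier-free `L_exp`-definable);
* `RealExpModel.rexpElementaryEmbedding`: **every embedding `k ↪ K` of models of `T_exp` is an
  elementary embedding `k | L_{exp↾} ↪ₑ K | L_{exp↾}`**.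

Nothing here is a named fact: the First Main Theorem is an explicit hypothesis.

## References

* A. J. Wilkie, J. Amer. Math. Soc. 9 (1996): First Main Theorem; Example (A) p. 1053; §1.
  [WilkieJAMS1996]
* M. den Besten, MSc thesis, Utrecht 2016: Theorem 2.1.1, Corollary 4.1.7, Lemma 6.2.3.
  [DenBesten2016]
-/

noncomputable section

open FirstOrder FirstOrder.Language FirstOrder.Language.Structure
open scoped FirstOrder

namespace Literature.ModelTheory.ExponentialFields

namespace RealExpModel

open OMinimalOfModelComplete

universe w

namespace IsExpTermDefinable

/-- **The graph of `exp↾[0,1]` is exp-term definable** (indeed quantifier-free: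
`((0 ≤ x ∧ x ≤ 1) ∧ y = exp x) ∨ ((¬ 0 ≤ x ∨ ¬ x ≤ 1) ∧ y = 0)`). [cite: DenBesten2016, Lemma 6.2.3] -/
theorem rexpGraph :
    IsExpTermDefinable (fun (K : Language.Theory.ModelType.{0, 0, w} realExpTheory)
      (u : Fin 1 ⊕ Unit → K) => u (Sum.inr ()) = RexpFun.rexp (u (Sum.inl 0))) := by
  let x : Language.orderedExpRing.Term (Fin 1 ⊕ Unit) := var (Sum.inl 0)
  let y : Language.orderedExpRing.Term (Fin 1 ⊕ Unit) := var (Sum.inr ())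
  have h : IsExpTermDefinable (fun (K : Language.Theory.ModelType.{0, 0, w} realExpTheory)
      (u : Fin 1 ⊕ Unit → K) =>
        (((0 : Language.orderedExpRing.Term (Fin 1 ⊕ Unit)).realize u ≤ x.realize u ∧
            x.realize u ≤ (1 : Language.orderedExpRing.Term (Fin 1 ⊕ Unit)).realize u) ∧
          y.realize u = (Language.orderedExpRing.termExp x).realize u) ∨
        ((¬ (0 : Language.orderedExpRing.Term (Fin 1 ⊕ Unit)).realize u ≤ x.realize u ∨
            ¬ x.realize u ≤ (1 : Language.orderedExpRing.Term (Fin 1 ⊕ Unit)).realize u) ∧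
          y.realize u = (0 : Language.orderedExpRing.Term (Fin 1 ⊕ Unit)).realize u)) :=
    (((le _ _).and (le _ _)).and (eq _ _)).or (((not_le _ _).or (not_le _ _)).and (eq _ _))
  refine h.congr fun K u => ?_
  simp only [x, y, realize_zero, realize_one, Term.realize_var, realize_termExp]
  rw [rexp_def]
  exact (rexpGraph_iff exp (u (Sum.inl 0)) (u (Sum.inr ()))).trans eq_comm

/-- The hypothesis `hfun` of `ExpTermReduction.lean` for the symbol `exp↾`. [cite: DenBesten2016, Lemma 6.2.3] -/
theorem funGraph_rexpUnary {l : ℕ} (g : Language.rexpUnary.Functions l) :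
    IsExpTermDefinable (fun (K : Language.Theory.ModelType.{0, 0, w} realExpTheory)
      (u : Fin l ⊕ Unit → K) => u (Sum.inr ()) = funMap g (u ∘ Sum.inl)) := by
  cases g
  exact rexpGraph.congr fun K u => Iff.rfl

/-- `{exp↾}` has no relation symbols. [folklore] -/
theorem relDef_rexpUnary {l : ℕ} (R : Language.rexpUnary.Relations l) :
    IsExpTermDefinable (fun (K : Language.Theory.ModelType.{0, 0, w} realExpTheory)
        (u : Fin l → K) => RelMap R u) ∧
      IsExpTermDefinable (fun (K : Language.Theory.ModelType.{0, 0, w} realExpTheory)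
        (u : Fin l → K) => ¬ RelMap R u) :=
  R.elim

/-- The hypotheses `hfun` for `L_{exp↾}`. [cite: DenBesten2016, Lemma 6.2.3] -/
theorem funGraph_orderedRexpRing {l : ℕ} (g : Language.orderedRexpRing.Functions l) :
    IsExpTermDefinable (fun (K : Language.Theory.ModelType.{0, 0, w} realExpTheory)
      (u : Fin l ⊕ Unit → K) => u (Sum.inr ()) = funMap g (u ∘ Sum.inl)) :=
  funGraph_sum funGraph_orderedRing funGraph_rexpUnary g

/-- The hypotheses `hrel` for `L_{exp↾}`. [folklore] -/
theorem relDef_orderedRexpRing {l : ℕ} (R : Language.orderedRexpRing.Relations l) :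
    IsExpTermDefinable (fun (K : Language.Theory.ModelType.{0, 0, w} realExpTheory)
        (u : Fin l → K) => RelMap R u) ∧
      IsExpTermDefinable (fun (K : Language.Theory.ModelType.{0, 0, w} realExpTheory)
        (u : Fin l → K) => ¬ RelMap R u) :=
  relDef_sum relDef_orderedRing relDef_rexpUnary R

/-- **Normal form of existential `L_{exp↾}`-conditions**: uniformly in the models of `T_exp`,
every existential `L_{exp↾}`-formula is a projection of one exponential term equation
(den Besten 2016, Lemma 2.1.5). [cite: DenBesten2016, Lemma 2.1.5] -/
theorem of_isExistential_orderedRexpRing {γ : Type} {n : ℕ}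
    {φ : Language.orderedRexpRing.BoundedFormula γ n} (hφ : φ.IsExistential) :
    IsExpTermDefinable (fun (K : Language.Theory.ModelType.{0, 0, w} realExpTheory)
        (u : γ ⊕ Fin n → K) => φ.Realize (u ∘ Sum.inl) (u ∘ Sum.inr)) :=
  of_isExistential_of_graphs funGraph_orderedRexpRing relDef_orderedRexpRing hφ

end IsExpTermDefinable

/-- `L_{exp↾}`-sentences transfer between any model of `T_exp` and `ℝ` presented as `realModel`.
[cite: DenBesten2016, Definition 1.2.2] -/
theorem realize_rSentence_iff_realModel (K : Language.Theory.ModelType.{0, 0, 0} realExpTheory)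
    (σ : Language.orderedRexpRing.Sentence) : (K : Type) ⊨ σ ↔ (realModel : Type) ⊨ σ :=
  (realize_rSentence_iff_real K σ).trans (realize_rSentence_iff_real realModel σ).symm

/-- **First Main Theorem ⇒ every `K | L_{exp↾}` is o-minimal** (`K ⊨ T_exp`): den Besten 2016,
Corollary 4.1.7 (there via `ℝ_an`), here via Khovanskii's finiteness theorem and the model
completeness of `T_{exp↾}` taken as the hypothesis `hMC` (Wilkie 1996, §1). [cite: DenBesten2016, Corollary 4.1.7] -/
theorem isOMinimal_orderedRexpRing_of_isModelComplete (hMC : rexpTheory.IsModelComplete)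
    (K : Language.Theory.ModelType.{0, 0, 0} realExpTheory) :
    Language.orderedRexpRing.IsOMinimal K :=
  isOMinimal_of_isModelComplete (T' := rexpTheory)
    (fun hψ => IsExpTermDefinable.of_isExistential_orderedRexpRing hψ)
    realize_rSentence_iff_realModel hMC K

/-- In particular `(ℝ; +, ·, -, 0, 1, exp↾[0,1], ≤)` (as the bundled model `realModel`) is
o-minimal, granted the First Main Theorem. [cite: DenBesten2016, Corollary 4.1.7] -/
theorem isOMinimal_orderedRexpRing_realModel_of_isModelComplete
    (hMC : rexpTheory.IsModelComplete) : Language.orderedRexpRing.IsOMinimal realModel :=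
  isOMinimal_orderedRexpRing_of_isModelComplete hMC realModel

/-- **`(ℝ; +, ·, -, 0, 1, exp↾[0,1], ≤)` itself is o-minimal, granted the First Main Theorem**
(den Besten 2016, Corollary 4.1.7, the standard model). [cite: DenBesten2016, Corollary 4.1.7] -/
theorem _root_.Literature.ModelTheory.ExponentialFields.Real.isOMinimal_orderedRexpRing_of_isModelComplete
    (hMC : rexpTheory.IsModelComplete) : Language.orderedRexpRing.IsOMinimal ℝ :=
  isOMinimal_real_of_isModelComplete (T' := rexpTheory)
    (fun hψ => IsExpTermDefinable.of_isExistential_orderedRexpRing hψ)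
    (fun σ h => (realize_rSentence_iff_real realModel σ).1 h) hMC

/-! ### `k | L_{exp↾} ≼ K | L_{exp↾}` -/

/-- **First Main Theorem ⇒ every embedding `f : k ↪ K` of models of `T_exp` is an elementary map
of the `exp↾`-reducts.** [cite: DenBesten2016, Theorem 2.1.1] -/
theorem realize_orderedRexpRing_comp_iff_of_isModelComplete (hMC : rexpTheory.IsModelComplete)
    {k K : Language.Theory.ModelType.{0, 0, 0} realExpTheory}
    (f : k ↪[Language.orderedExpRing] K) {n : ℕ} (φ : Language.orderedRexpRing.Formula (Fin n))
    (x : Fin n → k) : φ.Realize (f ∘ x) ↔ φ.Realize x :=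
  hMC (rexpModel k) (rexpModel K) (rexpEmbedding f) n φ x

/-- **The `exp↾`-reduct of an embedding of models of `T_exp` as an elementary embedding of
`L_{exp↾}`-structures**, granted the First Main Theorem. [cite: DenBesten2016, Theorem 2.1.1] -/
def rexpElementaryEmbedding (hMC : rexpTheory.IsModelComplete)
    {k K : Language.Theory.ModelType.{0, 0, 0} realExpTheory}
    (f : k ↪[Language.orderedExpRing] K) : k ↪ₑ[Language.orderedRexpRing] K where
  toFun := f
  map_formula' := fun _ φ x => realize_orderedRexpRing_comp_iff_of_isModelComplete hMC f φ x

/-- The underlying map of `rexpElementaryEmbedding hMC f` is `f`. [folklore] -/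
@[simp]
theorem rexpElementaryEmbedding_apply (hMC : rexpTheory.IsModelComplete)
    {k K : Language.Theory.ModelType.{0, 0, 0} realExpTheory}
    (f : k ↪[Language.orderedExpRing] K) (a : k) : rexpElementaryEmbedding hMC f a = f a :=
  rfl

end RealExpModel

end Literature.ModelTheory.ExponentialFields
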